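import Summits.CriticalPhenomena.PercolationContinuityZ3.Theorems.SahiMasterFamilyCommonConstraint

/-!
# Sahi positivity, EVERY order: private disjoint cores with a CHAIN of increasing constraints —
# `E_{k+1}(μ_p; 1_{[K_0] ∩ D_0}, …, 1_{[K_k] ∩ D_k}) ≥ 0` for pairwise disjoint `K_j` and pairwise `⊆`-comparable increasing `D_j`

Unit `prim-masterthm-p4` (gen 14; crux anchor stmt-CriticalPhenomena-4575, helper work; memo
`run/shared/lean/prim/prim-masterthm/prim-masterthm-p4/P4-GEN14-REPORT.md` §4).  Generalises `…CommonConstraint` (all `D_j` equal) and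
contains Lieb–Sahi's chain lemma [LiebSahi2021, Lemma 3.2] / [Blinovsky2013] (all `K_j = ∅`).  The cell's push-down theorem
(`SahiChainTensor.sahiE_prodWeight_chainInd_mul_nonneg`, seat l12-p5) tensors a hereditarily nonnegative family with a chain of events on an
INDEPENDENT factor; here the constraints `D_j` are arbitrary increasing events of the SAME space and may depend on the cores themselves
(e.g. `D_j = {at least r_j coordinates of ⋃K_i open}` with `r_0 ≤ r_1 ≤ ⋯`), at the price of the first factors being core cylinders.

PROOF.  β-normal form (`PrincipalCapBeta.sahiE_ind_eq_mul_phiSet`): `β_B = μ_p(⋂_{j∈B} D_j ∩ [K_B]) / μ_p[K_B]`; for a chain,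
`⋂_{j∈B} D_j` is one of the `D_j` (`exists_biInter_eq_of_chain`), and `μ_p(D ∩ [K_B])/μ_p[K_B]` is nondecreasing in `B` for every increasing
`D` (conditional Harris on the cylinder, `condProb_cyl_mono`); hence `β(S ∪ T) ≥ min(β S, β T)` (the intersection over `S ∪ T` is the
intersection over `S` or over `T`) and the MIN-CLOSED theorem `PhiMinClosed.phiSet_nonneg_of_minClosed` applies.  No principal-cap / top
hypothesis.  HONEST FRAMING: an unconditional all-orders stratum of Sahi's `C_k` for product measures; `C_k` in general, Kahn's Conjecture 5
and the master theorem remain OPEN.  Axioms standard. [this work]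
-/

noncomputable section

open scoped Classical

namespace Summit.CriticalPhenomena.PercolationContinuityZ3.Theorems

namespace ChainConstraint

open Finset Function MeasureTheory
open Literature.Combinatorics.Sahi2008
open Literature.Probability.Percolation.DecisionTree (ind ind_nonneg)
open PrincipalCapBeta (phiSet cyl coreP mom beta)

variable {ι : Type} [Fintype ι] {k : ℕ}

omit [Fintype ι] in
/-- In a `⊆`-chain of sets, the intersection over a nonempty finset of indices is one of the sets. [folklore] -/
theorem exists_biInter_eq_of_chain {D : Fin k → Set (Set ι)} (hch : ∀ i j, D i ⊆ D j ∨ D j ⊆ D i) :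
    ∀ B : Finset (Fin k), B.Nonempty → ∃ j₀ ∈ B, (⋂ j ∈ B, D j) = D j₀ := by
  intro B
  induction B using Finset.induction_on with
  | empty => intro h; exact absurd h (by simp)
  | insert a s ha ih =>
    intro _
    rcases s.eq_empty_or_nonempty with hs | hs
    · refine ⟨a, mem_insert_self a s, ?_⟩
      rw [hs, insert_empty]
      ext ω; simp
    · obtain ⟨j₀, hj₀, hj₀eq⟩ := ih hs
      have hsplit : (⋂ j ∈ insert a s, D j) = D a ∩ ⋂ j ∈ s, D j := by
        rw [Finset.set_biInter_insert]
      rw [hsplit, hj₀eq]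
      rcases hch a j₀ with h | h
      · exact ⟨a, mem_insert_self a s, Set.inter_eq_left.2 h⟩
      · exact ⟨j₀, mem_insert_of_mem hj₀, Set.inter_eq_right.2 h⟩

omit [Fintype ι] in
/-- `⋂_{j∈B} ([K_j] ∩ D_j) = (⋂_{j∈B} D_j) ∩ [K_B]`. [folklore] -/
theorem biInter_cyl_inter_family (K : Fin k → Finset ι) (D : Fin k → Set (Set ι)) (B : Finset (Fin k)) :
    (⋂ j ∈ B, (cyl (K j) ∩ D j)) = (⋂ j ∈ B, D j) ∩ {ω : Set ι | (↑(B.biUnion K) : Set ι) ⊆ ω} := by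
  rw [← CommonConstraint.biInter_cyl]
  ext ω
  simp only [Set.mem_iInter, Set.mem_inter_iff]
  constructor
  · intro h; exact ⟨fun j hj => (h j hj).2, fun j hj => (h j hj).1⟩
  · rintro ⟨h1, h2⟩ j hj; exact ⟨h2 j hj, h1 j hj⟩

/-- **Conditional Harris, monotone form**: for an increasing event `D` and `B ⊆ B'` (all cores of positive probability),
`μ(D ∩ [K_B])·μ[K_{B'}] ≤ μ[K_B]·μ(D ∩ [K_{B'}])`, i.e. `μ(D | [K_B]) ≤ μ(D | [K_{B'}])`. [this work] -/
theorem condProb_cyl_mono (p : ι → unitInterval) {K : Fin k → Finset ι} (hdisj : ∀ i j, i ≠ j → Disjoint (K i) (K j))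
    {D : Set (Set ι)} (hD : IsUpperSet D) {B B' : Finset (Fin k)} (hBB' : B ⊆ B') :
    ex (bernoulliWeight p) (ind (D ∩ {ω : Set ι | (↑(B.biUnion K) : Set ι) ⊆ ω})) * (∏ j ∈ B', coreP p K j) ≤
      (∏ j ∈ B, coreP p K j) * ex (bernoulliWeight p) (ind (D ∩ {ω : Set ι | (↑(B'.biUnion K) : Set ι) ⊆ ω})) := by
  set C : Set (Set ι) := {ω | (↑(B.biUnion K) : Set ι) ⊆ ω} with hC
  set C' : Set (Set ι) := {ω | (↑(B'.biUnion K) : Set ι) ⊆ ω} with hC'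
  have hCup : IsUpperSet C' := PrincipalCapBeta.isUpperSet_cyl _
  have hC'C : C' ⊆ C := fun ω hω => Set.Subset.trans (by
    rw [Finset.coe_subset]; exact Finset.biUnion_subset_biUnion_of_subset_left K hBB') hω
  have hPC : ex (bernoulliWeight p) (ind C) = ∏ j ∈ B, coreP p K j := by
    rw [← PrincipalCapBeta.prod_biUnion_coreP p hdisj]; exact PrincipalCapBeta.ex_ind_cyl p _
  have hPC' : ex (bernoulliWeight p) (ind C') = ∏ j ∈ B', coreP p K j := by
    rw [← PrincipalCapBeta.prod_biUnion_coreP p hdisj]; exact PrincipalCapBeta.ex_ind_cyl p _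
  have key := condHarris_ex_ind_cylinder p (↑(B.biUnion K) : Set ι) hD hCup
  have e1 : C' ∩ C = C' := Set.inter_eq_left.2 hC'C
  have e2 : D ∩ C' ∩ C = D ∩ C' := by rw [Set.inter_assoc, e1]
  rw [e1, e2, hPC, hPC'] at key
  exact key

/-- **THEOREM (every order): `E_{k+1}(μ_p; 1_{[K_0]∩D_0},…,1_{[K_k]∩D_k}) ≥ 0`** for pairwise disjoint `K_j` and a `⊆`-chain of
increasing events `D_j`, every product measure. [this work] -/
theorem sahiE_ind_cyl_inter_chain_nonneg (p : ι → unitInterval) (K : Fin (k + 1) → Finset ι)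
    (hdisj : ∀ i j, i ≠ j → Disjoint (K i) (K j)) (D : Fin (k + 1) → Set (Set ι)) (hD : ∀ j, IsUpperSet (D j))
    (hch : ∀ i j, D i ⊆ D j ∨ D j ⊆ D i) :
    0 ≤ sahiE (bernoulliWeight p) (k + 1) (fun j => ind (cyl (K j) ∩ D j)) := by
  have hsub : ∀ j, cyl (K j) ∩ D j ⊆ cyl (K j) := fun j => Set.inter_subset_left
  rw [PrincipalCapBeta.sahiE_ind_eq_mul_phiSet p (fun j => cyl (K j) ∩ D j) K hdisj hsub]
  by_cases hP : ∏ j, coreP p K j = 0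
  · rw [hP, zero_mul]
  have hpos : ∀ j, coreP p K j ≠ 0 := fun j h0 => hP (prod_eq_zero (mem_univ j) h0)
  have hPn : ∀ A : Finset (Fin (k + 1)), 0 < ∏ j ∈ A, coreP p K j := fun A =>
    lt_of_le_of_ne (prod_nonneg fun j _ => PrincipalCapBeta.coreP_nonneg p K j) (Ne.symm (prod_ne_zero_iff.2 fun j _ => hpos j))
  -- β_B = μ(D_{j(B)} ∩ [K_B]) / P_B, and the comparison β_S ≤ β_{S∪T} when ⋂_{S∪T} D = ⋂_S D
  have hmono : ∀ {S S' : Finset (Fin (k + 1))}, S ⊆ S' → (⋂ j ∈ S', D j) = (⋂ j ∈ S, D j) →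
      beta p (fun j => cyl (K j) ∩ D j) K S ≤ beta p (fun j => cyl (K j) ∩ D j) K S' := by
    intro S S' hSS' hint
    unfold PrincipalCapBeta.beta PrincipalCapBeta.mom
    rw [biInter_cyl_inter_family, biInter_cyl_inter_family, hint, div_le_div_iff₀ (hPn S) (hPn S')]
    have hup : IsUpperSet (⋂ j ∈ S, D j) := isUpperSet_iInter₂ fun j _ => hD j
    calc ex (bernoulliWeight p) (ind ((⋂ j ∈ S, D j) ∩ {ω : Set ι | (↑(S.biUnion K) : Set ι) ⊆ ω})) * ∏ j ∈ S', coreP p K j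
        ≤ (∏ j ∈ S, coreP p K j) * ex (bernoulliWeight p) (ind ((⋂ j ∈ S, D j) ∩ {ω : Set ι | (↑(S'.biUnion K) : Set ι) ⊆ ω})) :=
          condProb_cyl_mono p hdisj hup hSS'
      _ = ex (bernoulliWeight p) (ind ((⋂ j ∈ S, D j) ∩ {ω : Set ι | (↑(S'.biUnion K) : Set ι) ⊆ ω})) * ∏ j ∈ S, coreP p K j :=
          mul_comm _ _
  refine mul_nonneg (prod_nonneg fun j _ => PrincipalCapBeta.coreP_nonneg p K j)
    (PhiMinClosed.phiSet_nonneg_of_minClosed _ (PrincipalCapBeta.beta_nonneg p _ K)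
      (PrincipalCapBeta.beta_le_one p hdisj hsub) fun S T => ?_)
  rcases S.eq_empty_or_nonempty with hS | hS
  · rw [hS, empty_union]; exact min_le_right _ _
  rcases T.eq_empty_or_nonempty with hT | hT
  · rw [hT, union_empty]; exact min_le_left _ _
  -- the intersection over `S ∪ T` is the intersection over `S` or over `T`
  obtain ⟨jS, hjS, hS_eq⟩ := exists_biInter_eq_of_chain hch S hS
  obtain ⟨jT, hjT, hT_eq⟩ := exists_biInter_eq_of_chain hch T hT
  have hU : (⋂ j ∈ S ∪ T, D j) = (⋂ j ∈ S, D j) ∩ ⋂ j ∈ T, D j := PrincipalCapBeta.biInter_union D S T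
  rcases hch jS jT with h | h
  · -- D_{jS} ⊆ D_{jT}: the intersection over `S ∪ T` equals the one over `S`
    have hint : (⋂ j ∈ S ∪ T, D j) = ⋂ j ∈ S, D j := by rw [hU, hS_eq, hT_eq, Set.inter_eq_left.2 h]
    exact (min_le_left _ _).trans (hmono subset_union_left hint)
  · have hint : (⋂ j ∈ S ∪ T, D j) = ⋂ j ∈ T, D j := by rw [hU, hS_eq, hT_eq, Set.inter_eq_right.2 h]
    exact (min_le_right _ _).trans (hmono subset_union_right hint)

end ChainConstraint

end Summit.CriticalPhenomena.PercolationContinuityZ3.Theorems
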